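import Summits.HodgeConjecture.HodgeConjecture.Theorems.HodgeLocusCensusUnitColumnRankLevelsPowers

/-!
# Hodge locus census — the unit-column census complex is `S_k`-equivariant (PROBE 35)

certified instances and evidence bearing on the general Hodge conjecture; no claim.  Theorem-only helper sheet of the unit-column line over
anchor 229 `…UnitColumnRankLevelsPowers` (the closed form `count_iterate_colR` of the multiplicities and gen 31's `colR`); nothing here is a
statement about Hodge loci.

WHAT.  The census matrices of anchors 229/351 are the matrices of `×q^y`, `q = x₁^{e+1} + ⋯ + x_k^{e+1}`, on `A = K[x₁,…,x_k]/(xᵢ^{e+2})` in monomial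
bases: rows = monomials `x^v` of one codegree, columns = monomials `x^m` of another, entry = the multiplicity of `x^v` in `q^y · x^m` (a `colR`-list
count).  The symmetric group `S_k` relabels the variables: `σ` sends the exponent function `v` to `v ∘ σ` (`(v ∘ σ)(l) = v(σ l)`), keeping the codegree
(`Equiv.sum_comp`); write `ρ_σ` for this relabeling of the index of a level (spelled inline as an anonymous-constructor function, no definition).
Since `q` is a symmetric polynomial, `×q^y` commutes with the relabeling.  This sheet proves that, on the literal matrices and at every codegree:
  §1 (SYM-ℕ) `count_iterate_colR_perm` — the multiplicity of `x^{v∘σ}` in `q^c · x^{m∘σ}` equals that of `x^v` in `q^c · x^m` (all `m v`, no hypothesis);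
     (SYM) `submatrix_perm_eq` — over every field, between ANY two codegrees `J` (rows) and `L` (columns): `M.submatrix ρ_σ ρ_σ = M`;
  §2 (EQV) `vecMul_comp_perm` — for every row vector `x`: `(x ∘ ρ_σ) ᵥ* M = (x ᵥ* M) ∘ ρ_σ` (the action commutes with every census matrix);
     (SYM-ker) `comp_perm_mem_ker`, (SYM-range) `comp_perm_mem_range` — relabeling preserves left kernels (cycles) and row spaces (boundaries);
  §3 (INV-ker) `comap_funLeft_ker_eq`, (INV-range) `comap_funLeft_range_eq` — as SUBSPACE identities: the preimage under the relabeling endomorphism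
     `LinearMap.funLeft K K ρ_σ` (`x ↦ x ∘ ρ_σ`) of the left kernel of `M_y(J → L)`, resp. of the row space of `M_c(X → J)`, is that subspace itself.
  §4 (HOM-W) `comap_subtype_le_comap_restrict`, (HOM-EQV) `mapQ_restrict_funLeft_bijective` — the TYPED CONSEQUENCE on homology: for the
     module `H = leftker M_y(J → L) ⧸ comap ker.subtype (rowspace M_c(X → J))` (the homology shape of anchors 355 / 362, all codegrees free)
     the relabeling restricted to the cycles descends to `H` (`Submodule.mapQ`, for ANY compatibility witnesses, which (SYM-ker)/(HOM-W) supply)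
     and the induced map `H → H` is BIJECTIVE (inverse: the map of `σ⁻¹`) — `S_k` acts on every census homology module by automorphisms,
     compatibly with the maps `i` (inclusion) and `d` (`×M_a`) of the hexagon by (EQV): the census `p`-complex and its Betti numbers (anchors
     349/355) are those of an `S_k`-EQUIVARIANT `p`-complex, fibre by fibre (anchor 229's label blocks are permuted among themselves; the
     stabiliser of a label acts on its Boolean block as in the modular homology of inclusion maps with a group action, V. B. Mnukhin &
     J. Siemons, J. Combin. Theory A 74 (1996) 287–300, doi:10.1006/jcta.1996.0051 — context only).
METHOD.  (SYM-ℕ): both sides are anchor 229's closed form `c! · [labels agree ∧ Z(v) ⊆ Z(m) ∧ #Z(m) = #Z(v) + c]`; the three conditions transport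
along `σ` (`Finset.map σ⁻¹` of the zero sets, `Finset.mem_map_equiv`, `Finset.card_map`).  (SYM) is (SYM-ℕ) entrywise.  (EQV): promote `ρ_σ` to an
`Equiv` of the row index (inverse `ρ_{σ⁻¹}`) and read `Matrix.submatrix_vecMul_equiv` on (SYM).  §3: (SYM-…) for `σ` and for `σ⁻¹`, composed back
along `ρ_σ ∘ ρ_{σ⁻¹} = id`.  §4: (SYM-range) unfolded through `LinearMap.restrict`; the inverse on the quotient is `mapQ` of `σ⁻¹`, checked on
representatives (`Submodule.Quotient.mk_surjective`, `Submodule.mapQ_apply`).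
NUMERICS FIRST (owner, file-backed under `HOME/pub-hlocus-ivhs-2/gen58/`): `num35.py` checks, on the LITERAL `colR` lists, (SYM-ℕ) for every
`σ ∈ S_k`, all `m, v ∈ {0,…,e+1}^k`, `c ≤ 3`: `k ≤ 3, e ≤ 2` → 120 276 instances (1 408 nonzero) and `k ≤ 4, e ≤ 2` → 7 066 164 instances (24 424
nonzero), 0 violations; (SYM) as matrices between all codegree pairs 31 140 instances `(k,e,c,J,L,σ)`, 0 violations; (EQV) over `GF(p)`,
`p ∈ {2,3,5}`, random `x`: 18 738 / 0; (INV) every left-kernel basis vector relabelled stays in the kernel: 27 462 / 0.  File hashes in the READY line.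
LITERATURE (context only; nothing imported or minted): as displayed.  No literature fact is used as a hypothesis.
EVIDENCE CLASS: kernel theorems about the census matrices; no census number changes; nothing here asserts anything about the Hodge conjecture.

Import: anchor 229 `…Theorems.HodgeLocusCensusUnitColumnRankLevelsPowers` BY NAME (hence gen 31's `colR`); theorem-only, definition-free;
Mathlib by name: `Matrix.submatrix_vecMul_equiv`, `Matrix.vecMulLinear_apply`, `LinearMap.funLeft_apply`, `Equiv.sum_comp`, `Equiv.apply_symm_apply`,
`Finset.mem_map_equiv`, `Finset.card_map`, `Submodule.mem_comap`, `LinearMap.mem_ker`, `LinearMap.coe_restrict_apply`, `Submodule.mapQ_apply`,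
`Submodule.Quotient.mk_surjective`, `Function.bijective_iff_has_inverse`.
-/

set_option linter.dupNamespace false
set_option autoImplicit false

namespace Summit.HodgeConjecture.HodgeConjecture.HodgeLocus.Census.UnitColumnSymmetry

open Summit.HodgeConjecture.HodgeConjecture.HodgeLocus.Census.ModelNonJumpC1All (colR)
open Summit.HodgeConjecture.HodgeConjecture.HodgeLocus.Census.UnitColumnRankLevelsPowers (count_iterate_colR)

/-- **(SYM-ℕ) RELABELING INVARIANCE OF THE MULTIPLICITIES.** For every permutation `σ` of the variables and all exponent functions `m, v`:
the multiplicity of `x^{v∘σ}` in `q^c · x^{m∘σ}` equals that of `x^v` in `q^c · x^m` (anchor 229's closed form `count_iterate_colR`: the label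
condition, the zero-set inclusion and the zero-set cardinalities are transported along `σ`). -/
theorem count_iterate_colR_perm {k e : ℕ} (c : ℕ) (σ : Equiv.Perm (Fin k)) (m v : Fin k → Fin (e + 2)) :
    ((List.flatMap (colR (e + 3)))^[c] [List.ofFn (fun i => (m (σ i) : ℕ))]).count (List.ofFn (fun i => (v (σ i) : ℕ))) =
      ((List.flatMap (colR (e + 3)))^[c] [List.ofFn (fun i => (m i : ℕ))]).count (List.ofFn (fun i => (v i : ℕ))) := by
  rw [count_iterate_colR c (fun i => m (σ i)) (fun i => v (σ i)), count_iterate_colR c m v]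
  have hz : ∀ (w : Fin k → Fin (e + 2)), Finset.univ.filter (fun l => ((w (σ l) : ℕ)) = 0) =
      (Finset.univ.filter (fun l => (w l : ℕ) = 0)).map σ.symm.toEmbedding := by
    intro w; ext x; simp [Finset.mem_map_equiv]
  refine if_congr ⟨fun h => ⟨fun l => by simpa using h.1 (σ.symm l), ?_, ?_⟩, fun h => ⟨fun l => h.1 (σ l), ?_, ?_⟩⟩ rfl rfl
  · intro x hx
    have hx' : σ.symm x ∈ Finset.univ.filter (fun l => ((v (σ l) : ℕ)) = 0) := by simpa using hx
    simpa using h.2.1 hx'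
  · have h3 := h.2.2; rw [hz m, hz v, Finset.card_map, Finset.card_map] at h3; exact h3
  · intro x hx
    have hx' : σ x ∈ Finset.univ.filter (fun l => (v l : ℕ) = 0) := by simpa using hx
    simpa using h.2.1 hx'
  · rw [hz m, hz v, Finset.card_map, Finset.card_map]; exact h.2.2

/-- **(SYM) THE CENSUS MATRICES ARE `S_k`-INVARIANT.** Over every field `K`, for every power `y`, ANY two codegrees `J` (rows), `L` (columns)
and every permutation `σ` of `Fin k`: re-indexing rows AND columns of anchor 229's multiplicity matrix of `×q^y` along the relabeling `v ↦ v ∘ σ`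
(which keeps the codegree, `Equiv.sum_comp`) returns the same matrix (`Matrix.submatrix`; entry by entry it is (SYM-ℕ); no relation between
`J` and `L` is needed — off `L = J + y(e+1)` both sides are the zero matrix). -/
theorem submatrix_perm_eq (K : Type*) [Field K] (k e y J L : ℕ) (σ : Equiv.Perm (Fin k)) :
    ((Matrix.of fun (v : {v : Fin k → Fin (e + 2) // (∑ i, (v i : ℕ)) + J = k * (e + 1)})
          (m : {m : Fin k → Fin (e + 2) // (∑ i, (m i : ℕ)) + L = k * (e + 1)}) =>
        ((((List.flatMap (colR (e + 3)))^[y] [List.ofFn (fun i => (m.1 i : ℕ))]).count (List.ofFn (fun i => (v.1 i : ℕ))) : ℕ) : K))).submatrix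
      (fun w : {w : Fin k → Fin (e + 2) // (∑ i, (w i : ℕ)) + J = k * (e + 1)} =>
        (⟨fun l => w.1 (σ l), by rw [Equiv.sum_comp σ (fun i => (w.1 i : ℕ))]; exact w.2⟩ :
          {w : Fin k → Fin (e + 2) // (∑ i, (w i : ℕ)) + J = k * (e + 1)}))
      (fun w : {w : Fin k → Fin (e + 2) // (∑ i, (w i : ℕ)) + L = k * (e + 1)} =>
        (⟨fun l => w.1 (σ l), by rw [Equiv.sum_comp σ (fun i => (w.1 i : ℕ))]; exact w.2⟩ :
          {w : Fin k → Fin (e + 2) // (∑ i, (w i : ℕ)) + L = k * (e + 1)})) =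
    (Matrix.of fun (v : {v : Fin k → Fin (e + 2) // (∑ i, (v i : ℕ)) + J = k * (e + 1)})
        (m : {m : Fin k → Fin (e + 2) // (∑ i, (m i : ℕ)) + L = k * (e + 1)}) =>
      ((((List.flatMap (colR (e + 3)))^[y] [List.ofFn (fun i => (m.1 i : ℕ))]).count (List.ofFn (fun i => (v.1 i : ℕ))) : ℕ) : K)) := by
  ext v m
  simp only [Matrix.submatrix_apply, Matrix.of_apply]
  exact congrArg (Nat.cast : ℕ → K) (count_iterate_colR_perm y σ m.1 v.1)

/-- **(EQV) EQUIVARIANCE.** For every row vector `x` at codegree `J` and every permutation `σ`: multiplying the RELABELLED vector `v ↦ x (v ∘ σ)`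
by the matrix of `×q^y` gives the relabelled product, `(x ∘ ρ_σ) ᵥ* M = (x ᵥ* M) ∘ ρ_σ` (`Matrix.submatrix_vecMul_equiv` on (SYM), with the
relabeling promoted to an `Equiv` of the row index whose inverse relabels along `σ⁻¹`).  The `S_k`-action commutes with the census complex. -/
theorem vecMul_comp_perm (K : Type*) [Field K] (k e y J L : ℕ) (σ : Equiv.Perm (Fin k))
    (x : {v : Fin k → Fin (e + 2) // (∑ i, (v i : ℕ)) + J = k * (e + 1)} → K) :
    Matrix.vecMul (x ∘ (fun w : {w : Fin k → Fin (e + 2) // (∑ i, (w i : ℕ)) + J = k * (e + 1)} =>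
        (⟨fun l => w.1 (σ l), by rw [Equiv.sum_comp σ (fun i => (w.1 i : ℕ))]; exact w.2⟩ :
          {w : Fin k → Fin (e + 2) // (∑ i, (w i : ℕ)) + J = k * (e + 1)})))
      ((Matrix.of fun (v : {v : Fin k → Fin (e + 2) // (∑ i, (v i : ℕ)) + J = k * (e + 1)})
        (m : {m : Fin k → Fin (e + 2) // (∑ i, (m i : ℕ)) + L = k * (e + 1)}) =>
      ((((List.flatMap (colR (e + 3)))^[y] [List.ofFn (fun i => (m.1 i : ℕ))]).count (List.ofFn (fun i => (v.1 i : ℕ))) : ℕ) : K))) =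
    (Matrix.vecMul x
      ((Matrix.of fun (v : {v : Fin k → Fin (e + 2) // (∑ i, (v i : ℕ)) + J = k * (e + 1)})
        (m : {m : Fin k → Fin (e + 2) // (∑ i, (m i : ℕ)) + L = k * (e + 1)}) =>
      ((((List.flatMap (colR (e + 3)))^[y] [List.ofFn (fun i => (m.1 i : ℕ))]).count (List.ofFn (fun i => (v.1 i : ℕ))) : ℕ) : K)))) ∘
      (fun w : {w : Fin k → Fin (e + 2) // (∑ i, (w i : ℕ)) + L = k * (e + 1)} =>
        (⟨fun l => w.1 (σ l), by rw [Equiv.sum_comp σ (fun i => (w.1 i : ℕ))]; exact w.2⟩ :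
          {w : Fin k → Fin (e + 2) // (∑ i, (w i : ℕ)) + L = k * (e + 1)})) := by
  let ρ : {w : Fin k → Fin (e + 2) // (∑ i, (w i : ℕ)) + J = k * (e + 1)} ≃ {w : Fin k → Fin (e + 2) // (∑ i, (w i : ℕ)) + J = k * (e + 1)} :=
    ⟨fun w => ⟨fun l => w.1 (σ l), by rw [Equiv.sum_comp σ (fun i => (w.1 i : ℕ))]; exact w.2⟩,
     fun w => ⟨fun l => w.1 (σ.symm l), by rw [Equiv.sum_comp σ.symm (fun i => (w.1 i : ℕ))]; exact w.2⟩,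
     fun w => Subtype.ext (funext fun l => by simp), fun w => Subtype.ext (funext fun l => by simp)⟩
  have hM := submatrix_perm_eq K k e y J L σ
  have h1 := Matrix.submatrix_vecMul_equiv
    ((Matrix.of fun (v : {v : Fin k → Fin (e + 2) // (∑ i, (v i : ℕ)) + J = k * (e + 1)})
        (m : {m : Fin k → Fin (e + 2) // (∑ i, (m i : ℕ)) + L = k * (e + 1)}) =>
      ((((List.flatMap (colR (e + 3)))^[y] [List.ofFn (fun i => (m.1 i : ℕ))]).count (List.ofFn (fun i => (v.1 i : ℕ))) : ℕ) : K)))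
    (x ∘ (fun w : {w : Fin k → Fin (e + 2) // (∑ i, (w i : ℕ)) + J = k * (e + 1)} =>
        (⟨fun l => w.1 (σ l), by rw [Equiv.sum_comp σ (fun i => (w.1 i : ℕ))]; exact w.2⟩ :
          {w : Fin k → Fin (e + 2) // (∑ i, (w i : ℕ)) + J = k * (e + 1)}))) ρ
    (fun w : {w : Fin k → Fin (e + 2) // (∑ i, (w i : ℕ)) + L = k * (e + 1)} =>
        (⟨fun l => w.1 (σ l), by rw [Equiv.sum_comp σ (fun i => (w.1 i : ℕ))]; exact w.2⟩ :
          {w : Fin k → Fin (e + 2) // (∑ i, (w i : ℕ)) + L = k * (e + 1)}))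
  have hρ : ((x ∘ (fun w : {w : Fin k → Fin (e + 2) // (∑ i, (w i : ℕ)) + J = k * (e + 1)} =>
        (⟨fun l => w.1 (σ l), by rw [Equiv.sum_comp σ (fun i => (w.1 i : ℕ))]; exact w.2⟩ :
          {w : Fin k → Fin (e + 2) // (∑ i, (w i : ℕ)) + J = k * (e + 1)}))) ∘ ρ.symm) = x := by
    funext w; simp only [Function.comp_apply]; congr 1; exact ρ.apply_symm_apply w
  rw [hρ] at h1
  have hρ' : (⇑ρ : {w : Fin k → Fin (e + 2) // (∑ i, (w i : ℕ)) + J = k * (e + 1)} → {w : Fin k → Fin (e + 2) // (∑ i, (w i : ℕ)) + J = k * (e + 1)}) =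
      (fun w : {w : Fin k → Fin (e + 2) // (∑ i, (w i : ℕ)) + J = k * (e + 1)} =>
        (⟨fun l => w.1 (σ l), by rw [Equiv.sum_comp σ (fun i => (w.1 i : ℕ))]; exact w.2⟩ :
          {w : Fin k → Fin (e + 2) // (∑ i, (w i : ℕ)) + J = k * (e + 1)})) := rfl
  rw [hρ', hM] at h1
  exact h1

/-- **(SYM-ker) RELABELING PRESERVES THE CYCLES.** For every `x` in the left kernel of `×q^y` at codegree `J` and every permutation `σ`, the
relabelled vector `v ↦ x (v ∘ σ)` is again in the left kernel ((EQV)). -/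
theorem comp_perm_mem_ker (K : Type*) [Field K] (k e y J L : ℕ) (σ : Equiv.Perm (Fin k))
    (x : {v : Fin k → Fin (e + 2) // (∑ i, (v i : ℕ)) + J = k * (e + 1)} → K)
    (hx : x ∈ LinearMap.ker (Matrix.vecMulLinear
      (Matrix.of fun (v : {v : Fin k → Fin (e + 2) // (∑ i, (v i : ℕ)) + J = k * (e + 1)})
          (m : {m : Fin k → Fin (e + 2) // (∑ i, (m i : ℕ)) + L = k * (e + 1)}) =>
        ((((List.flatMap (colR (e + 3)))^[y] [List.ofFn (fun i => (m.1 i : ℕ))]).count (List.ofFn (fun i => (v.1 i : ℕ))) : ℕ) : K)))) :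
    (x ∘ (fun w : {w : Fin k → Fin (e + 2) // (∑ i, (w i : ℕ)) + J = k * (e + 1)} =>
        (⟨fun l => w.1 (σ l), by rw [Equiv.sum_comp σ (fun i => (w.1 i : ℕ))]; exact w.2⟩ :
          {w : Fin k → Fin (e + 2) // (∑ i, (w i : ℕ)) + J = k * (e + 1)}))) ∈
      LinearMap.ker (Matrix.vecMulLinear
      (Matrix.of fun (v : {v : Fin k → Fin (e + 2) // (∑ i, (v i : ℕ)) + J = k * (e + 1)})
          (m : {m : Fin k → Fin (e + 2) // (∑ i, (m i : ℕ)) + L = k * (e + 1)}) =>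
        ((((List.flatMap (colR (e + 3)))^[y] [List.ofFn (fun i => (m.1 i : ℕ))]).count (List.ofFn (fun i => (v.1 i : ℕ))) : ℕ) : K))) := by
  rw [LinearMap.mem_ker, Matrix.vecMulLinear_apply] at hx ⊢
  rw [vecMul_comp_perm K k e y J L σ x, hx]; rfl

/-- **(SYM-range) RELABELING PRESERVES THE BOUNDARIES.** For every `x` in the row space of `×q^c` INTO codegree `J` (from codegree `X`) and every
permutation `σ`, the relabelled vector is again in that row space: a preimage `w` relabels to the preimage `w ∘ ρ_σ` ((EQV) at level `X`). -/
theorem comp_perm_mem_range (K : Type*) [Field K] (k e c X J : ℕ) (σ : Equiv.Perm (Fin k))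
    (x : {v : Fin k → Fin (e + 2) // (∑ i, (v i : ℕ)) + J = k * (e + 1)} → K)
    (hx : x ∈ LinearMap.range (Matrix.vecMulLinear
      (Matrix.of fun (v : {v : Fin k → Fin (e + 2) // (∑ i, (v i : ℕ)) + X = k * (e + 1)})
          (m : {m : Fin k → Fin (e + 2) // (∑ i, (m i : ℕ)) + J = k * (e + 1)}) =>
        ((((List.flatMap (colR (e + 3)))^[c] [List.ofFn (fun i => (m.1 i : ℕ))]).count (List.ofFn (fun i => (v.1 i : ℕ))) : ℕ) : K)))) :
    (x ∘ (fun w : {w : Fin k → Fin (e + 2) // (∑ i, (w i : ℕ)) + J = k * (e + 1)} =>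
        (⟨fun l => w.1 (σ l), by rw [Equiv.sum_comp σ (fun i => (w.1 i : ℕ))]; exact w.2⟩ :
          {w : Fin k → Fin (e + 2) // (∑ i, (w i : ℕ)) + J = k * (e + 1)}))) ∈
      LinearMap.range (Matrix.vecMulLinear
      (Matrix.of fun (v : {v : Fin k → Fin (e + 2) // (∑ i, (v i : ℕ)) + X = k * (e + 1)})
          (m : {m : Fin k → Fin (e + 2) // (∑ i, (m i : ℕ)) + J = k * (e + 1)}) =>
        ((((List.flatMap (colR (e + 3)))^[c] [List.ofFn (fun i => (m.1 i : ℕ))]).count (List.ofFn (fun i => (v.1 i : ℕ))) : ℕ) : K))) := by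
  obtain ⟨w, hw⟩ := hx
  refine ⟨w ∘ (fun w : {w : Fin k → Fin (e + 2) // (∑ i, (w i : ℕ)) + X = k * (e + 1)} =>
        (⟨fun l => w.1 (σ l), by rw [Equiv.sum_comp σ (fun i => (w.1 i : ℕ))]; exact w.2⟩ :
          {w : Fin k → Fin (e + 2) // (∑ i, (w i : ℕ)) + X = k * (e + 1)})), ?_⟩
  rw [Matrix.vecMulLinear_apply] at hw ⊢
  rw [vecMul_comp_perm K k e c X J σ w, hw]

/-- **(INV-ker) THE CYCLES ARE A RELABELING-STABLE SUBSPACE**: the preimage of the left kernel under the relabeling endomorphism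
`LinearMap.funLeft K K ρ_σ` (`x ↦ x ∘ ρ_σ`) of the row space at codegree `J` IS the left kernel ((SYM-ker) for `σ` gives `⊇`, for `σ⁻¹` — composed
back along `ρ_σ ∘ ρ_{σ⁻¹} = id` — gives `⊆`). -/
theorem comap_funLeft_ker_eq (K : Type*) [Field K] (k e y J L : ℕ) (σ : Equiv.Perm (Fin k)) :
    Submodule.comap (LinearMap.funLeft K K
      (fun w : {w : Fin k → Fin (e + 2) // (∑ i, (w i : ℕ)) + J = k * (e + 1)} =>
        (⟨fun l => w.1 (σ l), by rw [Equiv.sum_comp σ (fun i => (w.1 i : ℕ))]; exact w.2⟩ :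
          {w : Fin k → Fin (e + 2) // (∑ i, (w i : ℕ)) + J = k * (e + 1)})))
      (LinearMap.ker (Matrix.vecMulLinear
      (Matrix.of fun (v : {v : Fin k → Fin (e + 2) // (∑ i, (v i : ℕ)) + J = k * (e + 1)})
          (m : {m : Fin k → Fin (e + 2) // (∑ i, (m i : ℕ)) + L = k * (e + 1)}) =>
        ((((List.flatMap (colR (e + 3)))^[y] [List.ofFn (fun i => (m.1 i : ℕ))]).count (List.ofFn (fun i => (v.1 i : ℕ))) : ℕ) : K)))) =
    LinearMap.ker (Matrix.vecMulLinear
      (Matrix.of fun (v : {v : Fin k → Fin (e + 2) // (∑ i, (v i : ℕ)) + J = k * (e + 1)})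
          (m : {m : Fin k → Fin (e + 2) // (∑ i, (m i : ℕ)) + L = k * (e + 1)}) =>
        ((((List.flatMap (colR (e + 3)))^[y] [List.ofFn (fun i => (m.1 i : ℕ))]).count (List.ofFn (fun i => (v.1 i : ℕ))) : ℕ) : K))) := by
  ext x
  rw [Submodule.mem_comap]
  refine ⟨fun h => ?_, fun h => comp_perm_mem_ker K k e y J L σ x h⟩
  have h2 := comp_perm_mem_ker K k e y J L σ.symm _ h
  have hid : ((LinearMap.funLeft K K
      (fun w : {w : Fin k → Fin (e + 2) // (∑ i, (w i : ℕ)) + J = k * (e + 1)} =>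
        (⟨fun l => w.1 (σ l), by rw [Equiv.sum_comp σ (fun i => (w.1 i : ℕ))]; exact w.2⟩ :
          {w : Fin k → Fin (e + 2) // (∑ i, (w i : ℕ)) + J = k * (e + 1)}))) x) ∘
      (fun w : {w : Fin k → Fin (e + 2) // (∑ i, (w i : ℕ)) + J = k * (e + 1)} =>
        (⟨fun l => w.1 (σ.symm l), by rw [Equiv.sum_comp σ.symm (fun i => (w.1 i : ℕ))]; exact w.2⟩ :
          {w : Fin k → Fin (e + 2) // (∑ i, (w i : ℕ)) + J = k * (e + 1)})) = x := by
    funext w; simp only [Function.comp_apply, LinearMap.funLeft_apply]; congr 1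
    exact Subtype.ext (funext fun l => by simp)
  rwa [hid] at h2

/-- **(INV-range) THE BOUNDARIES ARE A RELABELING-STABLE SUBSPACE**: the same for the row space of `×q^c` from codegree `X` into `J` ((SYM-range)
for `σ` and `σ⁻¹`).  With (INV-ker): the relabeling automorphisms act on every census homology module `H_(y)(J ← X) = ker ⧸ (range inside ker)`
of anchors 355 / 362, compatibly with the maps `i` and `d` of the hexagon ((EQV)) — the census complex is an `S_k`-EQUIVARIANT `p`-complex. -/
theorem comap_funLeft_range_eq (K : Type*) [Field K] (k e c X J : ℕ) (σ : Equiv.Perm (Fin k)) :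
    Submodule.comap (LinearMap.funLeft K K
      (fun w : {w : Fin k → Fin (e + 2) // (∑ i, (w i : ℕ)) + J = k * (e + 1)} =>
        (⟨fun l => w.1 (σ l), by rw [Equiv.sum_comp σ (fun i => (w.1 i : ℕ))]; exact w.2⟩ :
          {w : Fin k → Fin (e + 2) // (∑ i, (w i : ℕ)) + J = k * (e + 1)})))
      (LinearMap.range (Matrix.vecMulLinear
      (Matrix.of fun (v : {v : Fin k → Fin (e + 2) // (∑ i, (v i : ℕ)) + X = k * (e + 1)})
          (m : {m : Fin k → Fin (e + 2) // (∑ i, (m i : ℕ)) + J = k * (e + 1)}) =>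
        ((((List.flatMap (colR (e + 3)))^[c] [List.ofFn (fun i => (m.1 i : ℕ))]).count (List.ofFn (fun i => (v.1 i : ℕ))) : ℕ) : K)))) =
    LinearMap.range (Matrix.vecMulLinear
      (Matrix.of fun (v : {v : Fin k → Fin (e + 2) // (∑ i, (v i : ℕ)) + X = k * (e + 1)})
          (m : {m : Fin k → Fin (e + 2) // (∑ i, (m i : ℕ)) + J = k * (e + 1)}) =>
        ((((List.flatMap (colR (e + 3)))^[c] [List.ofFn (fun i => (m.1 i : ℕ))]).count (List.ofFn (fun i => (v.1 i : ℕ))) : ℕ) : K))) := by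
  ext x
  rw [Submodule.mem_comap]
  refine ⟨fun h => ?_, fun h => comp_perm_mem_range K k e c X J σ x h⟩
  have h2 := comp_perm_mem_range K k e c X J σ.symm _ h
  have hid : ((LinearMap.funLeft K K
      (fun w : {w : Fin k → Fin (e + 2) // (∑ i, (w i : ℕ)) + J = k * (e + 1)} =>
        (⟨fun l => w.1 (σ l), by rw [Equiv.sum_comp σ (fun i => (w.1 i : ℕ))]; exact w.2⟩ :
          {w : Fin k → Fin (e + 2) // (∑ i, (w i : ℕ)) + J = k * (e + 1)}))) x) ∘
      (fun w : {w : Fin k → Fin (e + 2) // (∑ i, (w i : ℕ)) + J = k * (e + 1)} =>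
        (⟨fun l => w.1 (σ.symm l), by rw [Equiv.sum_comp σ.symm (fun i => (w.1 i : ℕ))]; exact w.2⟩ :
          {w : Fin k → Fin (e + 2) // (∑ i, (w i : ℕ)) + J = k * (e + 1)})) = x := by
    funext w; simp only [Function.comp_apply, LinearMap.funLeft_apply]; congr 1
    exact Subtype.ext (funext fun l => by simp)
  rwa [hid] at h2

/-- **(HOM-W) ON THE CYCLES, THE RELABELING MAPS BOUNDARIES TO BOUNDARIES.** For every witness `h₁` that the relabeling endomorphism
`x ↦ x ∘ ρ_σ` maps the left kernel of `M_y(J → L)` into itself ((SYM-ker) provides one), its restriction to that kernel maps the boundary submodule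
`D = (rowspace M_c(X → J)) ∩ ker`, read inside the kernel (`Submodule.comap ker.subtype range`, the typed boundaries of anchors 355 / 362), into
`D` ((SYM-range)) — the compatibility needed to descend to the homology quotient. -/
theorem comap_subtype_le_comap_restrict (K : Type*) [Field K] (k e y c X J L : ℕ) (σ : Equiv.Perm (Fin k))
    (h₁ : ∀ x ∈ LinearMap.ker (Matrix.vecMulLinear
      (Matrix.of fun (v : {v : Fin k → Fin (e + 2) // (∑ i, (v i : ℕ)) + J = k * (e + 1)})
          (m : {m : Fin k → Fin (e + 2) // (∑ i, (m i : ℕ)) + L = k * (e + 1)}) =>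
        ((((List.flatMap (colR (e + 3)))^[y] [List.ofFn (fun i => (m.1 i : ℕ))]).count (List.ofFn (fun i => (v.1 i : ℕ))) : ℕ) : K))),
      (LinearMap.funLeft K K
      (fun w : {w : Fin k → Fin (e + 2) // (∑ i, (w i : ℕ)) + J = k * (e + 1)} =>
        (⟨fun l => w.1 (σ l), by rw [Equiv.sum_comp σ (fun i => (w.1 i : ℕ))]; exact w.2⟩ :
          {w : Fin k → Fin (e + 2) // (∑ i, (w i : ℕ)) + J = k * (e + 1)}))) x ∈
      LinearMap.ker (Matrix.vecMulLinear
      (Matrix.of fun (v : {v : Fin k → Fin (e + 2) // (∑ i, (v i : ℕ)) + J = k * (e + 1)})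
          (m : {m : Fin k → Fin (e + 2) // (∑ i, (m i : ℕ)) + L = k * (e + 1)}) =>
        ((((List.flatMap (colR (e + 3)))^[y] [List.ofFn (fun i => (m.1 i : ℕ))]).count (List.ofFn (fun i => (v.1 i : ℕ))) : ℕ) : K)))) :
    Submodule.comap (LinearMap.ker (Matrix.vecMulLinear
      (Matrix.of fun (v : {v : Fin k → Fin (e + 2) // (∑ i, (v i : ℕ)) + J = k * (e + 1)})
          (m : {m : Fin k → Fin (e + 2) // (∑ i, (m i : ℕ)) + L = k * (e + 1)}) =>
        ((((List.flatMap (colR (e + 3)))^[y] [List.ofFn (fun i => (m.1 i : ℕ))]).count (List.ofFn (fun i => (v.1 i : ℕ))) : ℕ) : K)))).subtype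
      (LinearMap.range (Matrix.vecMulLinear
      (Matrix.of fun (v : {v : Fin k → Fin (e + 2) // (∑ i, (v i : ℕ)) + X = k * (e + 1)})
          (m : {m : Fin k → Fin (e + 2) // (∑ i, (m i : ℕ)) + J = k * (e + 1)}) =>
        ((((List.flatMap (colR (e + 3)))^[c] [List.ofFn (fun i => (m.1 i : ℕ))]).count (List.ofFn (fun i => (v.1 i : ℕ))) : ℕ) : K)))) ≤
    Submodule.comap ((LinearMap.funLeft K K
      (fun w : {w : Fin k → Fin (e + 2) // (∑ i, (w i : ℕ)) + J = k * (e + 1)} =>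
        (⟨fun l => w.1 (σ l), by rw [Equiv.sum_comp σ (fun i => (w.1 i : ℕ))]; exact w.2⟩ :
          {w : Fin k → Fin (e + 2) // (∑ i, (w i : ℕ)) + J = k * (e + 1)}))).restrict h₁)
      (Submodule.comap (LinearMap.ker (Matrix.vecMulLinear
      (Matrix.of fun (v : {v : Fin k → Fin (e + 2) // (∑ i, (v i : ℕ)) + J = k * (e + 1)})
          (m : {m : Fin k → Fin (e + 2) // (∑ i, (m i : ℕ)) + L = k * (e + 1)}) =>
        ((((List.flatMap (colR (e + 3)))^[y] [List.ofFn (fun i => (m.1 i : ℕ))]).count (List.ofFn (fun i => (v.1 i : ℕ))) : ℕ) : K)))).subtype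
        (LinearMap.range (Matrix.vecMulLinear
      (Matrix.of fun (v : {v : Fin k → Fin (e + 2) // (∑ i, (v i : ℕ)) + X = k * (e + 1)})
          (m : {m : Fin k → Fin (e + 2) // (∑ i, (m i : ℕ)) + J = k * (e + 1)}) =>
        ((((List.flatMap (colR (e + 3)))^[c] [List.ofFn (fun i => (m.1 i : ℕ))]).count (List.ofFn (fun i => (v.1 i : ℕ))) : ℕ) : K))))) := by
  intro z hz
  rw [Submodule.mem_comap] at hz ⊢
  rw [Submodule.mem_comap, Submodule.subtype_apply, LinearMap.coe_restrict_apply]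
  rw [Submodule.subtype_apply] at hz
  exact comp_perm_mem_range K k e c X J σ _ hz

/-- **(HOM-EQV) `S_k` ACTS ON THE CENSUS HOMOLOGY BY AUTOMORPHISMS.** For the homology module `H = ker M_y(J → L) ⧸ D`,
`D = comap ker.subtype (rowspace M_c(X → J))` (anchors 355 / 362 shape, all codegrees free), and every permutation `σ`: the linear map
`H → H` induced (`Submodule.mapQ`) by the relabeling `x ↦ x ∘ ρ_σ` restricted to the cycles — for ANY compatibility witnesses `h₁` ((SYM-ker)) and
`h₂` ((HOM-W)) — is BIJECTIVE; its inverse is the map induced by `σ⁻¹` (`ρ_σ ∘ ρ_{σ⁻¹} = id = ρ_{σ⁻¹} ∘ ρ_σ` on the index). -/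
theorem mapQ_restrict_funLeft_bijective (K : Type*) [Field K] (k e y c X J L : ℕ) (σ : Equiv.Perm (Fin k))
    (h₁ : ∀ x ∈ LinearMap.ker (Matrix.vecMulLinear
      (Matrix.of fun (v : {v : Fin k → Fin (e + 2) // (∑ i, (v i : ℕ)) + J = k * (e + 1)})
          (m : {m : Fin k → Fin (e + 2) // (∑ i, (m i : ℕ)) + L = k * (e + 1)}) =>
        ((((List.flatMap (colR (e + 3)))^[y] [List.ofFn (fun i => (m.1 i : ℕ))]).count (List.ofFn (fun i => (v.1 i : ℕ))) : ℕ) : K))),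
      (LinearMap.funLeft K K
      (fun w : {w : Fin k → Fin (e + 2) // (∑ i, (w i : ℕ)) + J = k * (e + 1)} =>
        (⟨fun l => w.1 (σ l), by rw [Equiv.sum_comp σ (fun i => (w.1 i : ℕ))]; exact w.2⟩ :
          {w : Fin k → Fin (e + 2) // (∑ i, (w i : ℕ)) + J = k * (e + 1)}))) x ∈
      LinearMap.ker (Matrix.vecMulLinear
      (Matrix.of fun (v : {v : Fin k → Fin (e + 2) // (∑ i, (v i : ℕ)) + J = k * (e + 1)})
          (m : {m : Fin k → Fin (e + 2) // (∑ i, (m i : ℕ)) + L = k * (e + 1)}) =>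
        ((((List.flatMap (colR (e + 3)))^[y] [List.ofFn (fun i => (m.1 i : ℕ))]).count (List.ofFn (fun i => (v.1 i : ℕ))) : ℕ) : K))))
    (h₂ : Submodule.comap (LinearMap.ker (Matrix.vecMulLinear
      (Matrix.of fun (v : {v : Fin k → Fin (e + 2) // (∑ i, (v i : ℕ)) + J = k * (e + 1)})
          (m : {m : Fin k → Fin (e + 2) // (∑ i, (m i : ℕ)) + L = k * (e + 1)}) =>
        ((((List.flatMap (colR (e + 3)))^[y] [List.ofFn (fun i => (m.1 i : ℕ))]).count (List.ofFn (fun i => (v.1 i : ℕ))) : ℕ) : K)))).subtype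
        (LinearMap.range (Matrix.vecMulLinear
      (Matrix.of fun (v : {v : Fin k → Fin (e + 2) // (∑ i, (v i : ℕ)) + X = k * (e + 1)})
          (m : {m : Fin k → Fin (e + 2) // (∑ i, (m i : ℕ)) + J = k * (e + 1)}) =>
        ((((List.flatMap (colR (e + 3)))^[c] [List.ofFn (fun i => (m.1 i : ℕ))]).count (List.ofFn (fun i => (v.1 i : ℕ))) : ℕ) : K)))) ≤
      Submodule.comap ((LinearMap.funLeft K K
        (fun w : {w : Fin k → Fin (e + 2) // (∑ i, (w i : ℕ)) + J = k * (e + 1)} =>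
        (⟨fun l => w.1 (σ l), by rw [Equiv.sum_comp σ (fun i => (w.1 i : ℕ))]; exact w.2⟩ :
          {w : Fin k → Fin (e + 2) // (∑ i, (w i : ℕ)) + J = k * (e + 1)}))).restrict h₁)
        (Submodule.comap (LinearMap.ker (Matrix.vecMulLinear
      (Matrix.of fun (v : {v : Fin k → Fin (e + 2) // (∑ i, (v i : ℕ)) + J = k * (e + 1)})
          (m : {m : Fin k → Fin (e + 2) // (∑ i, (m i : ℕ)) + L = k * (e + 1)}) =>
        ((((List.flatMap (colR (e + 3)))^[y] [List.ofFn (fun i => (m.1 i : ℕ))]).count (List.ofFn (fun i => (v.1 i : ℕ))) : ℕ) : K)))).subtype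
          (LinearMap.range (Matrix.vecMulLinear
      (Matrix.of fun (v : {v : Fin k → Fin (e + 2) // (∑ i, (v i : ℕ)) + X = k * (e + 1)})
          (m : {m : Fin k → Fin (e + 2) // (∑ i, (m i : ℕ)) + J = k * (e + 1)}) =>
        ((((List.flatMap (colR (e + 3)))^[c] [List.ofFn (fun i => (m.1 i : ℕ))]).count (List.ofFn (fun i => (v.1 i : ℕ))) : ℕ) : K)))))) :
    Function.Bijective (Submodule.mapQ
      (Submodule.comap (LinearMap.ker (Matrix.vecMulLinear
      (Matrix.of fun (v : {v : Fin k → Fin (e + 2) // (∑ i, (v i : ℕ)) + J = k * (e + 1)})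
          (m : {m : Fin k → Fin (e + 2) // (∑ i, (m i : ℕ)) + L = k * (e + 1)}) =>
        ((((List.flatMap (colR (e + 3)))^[y] [List.ofFn (fun i => (m.1 i : ℕ))]).count (List.ofFn (fun i => (v.1 i : ℕ))) : ℕ) : K)))).subtype
        (LinearMap.range (Matrix.vecMulLinear
      (Matrix.of fun (v : {v : Fin k → Fin (e + 2) // (∑ i, (v i : ℕ)) + X = k * (e + 1)})
          (m : {m : Fin k → Fin (e + 2) // (∑ i, (m i : ℕ)) + J = k * (e + 1)}) =>
        ((((List.flatMap (colR (e + 3)))^[c] [List.ofFn (fun i => (m.1 i : ℕ))]).count (List.ofFn (fun i => (v.1 i : ℕ))) : ℕ) : K)))))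
      (Submodule.comap (LinearMap.ker (Matrix.vecMulLinear
      (Matrix.of fun (v : {v : Fin k → Fin (e + 2) // (∑ i, (v i : ℕ)) + J = k * (e + 1)})
          (m : {m : Fin k → Fin (e + 2) // (∑ i, (m i : ℕ)) + L = k * (e + 1)}) =>
        ((((List.flatMap (colR (e + 3)))^[y] [List.ofFn (fun i => (m.1 i : ℕ))]).count (List.ofFn (fun i => (v.1 i : ℕ))) : ℕ) : K)))).subtype
        (LinearMap.range (Matrix.vecMulLinear
      (Matrix.of fun (v : {v : Fin k → Fin (e + 2) // (∑ i, (v i : ℕ)) + X = k * (e + 1)})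
          (m : {m : Fin k → Fin (e + 2) // (∑ i, (m i : ℕ)) + J = k * (e + 1)}) =>
        ((((List.flatMap (colR (e + 3)))^[c] [List.ofFn (fun i => (m.1 i : ℕ))]).count (List.ofFn (fun i => (v.1 i : ℕ))) : ℕ) : K)))))
      ((LinearMap.funLeft K K
        (fun w : {w : Fin k → Fin (e + 2) // (∑ i, (w i : ℕ)) + J = k * (e + 1)} =>
        (⟨fun l => w.1 (σ l), by rw [Equiv.sum_comp σ (fun i => (w.1 i : ℕ))]; exact w.2⟩ :
          {w : Fin k → Fin (e + 2) // (∑ i, (w i : ℕ)) + J = k * (e + 1)}))).restrict h₁) h₂) := by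
  have g₁ : ∀ x ∈ LinearMap.ker (Matrix.vecMulLinear
      (Matrix.of fun (v : {v : Fin k → Fin (e + 2) // (∑ i, (v i : ℕ)) + J = k * (e + 1)})
          (m : {m : Fin k → Fin (e + 2) // (∑ i, (m i : ℕ)) + L = k * (e + 1)}) =>
        ((((List.flatMap (colR (e + 3)))^[y] [List.ofFn (fun i => (m.1 i : ℕ))]).count (List.ofFn (fun i => (v.1 i : ℕ))) : ℕ) : K))),
      (LinearMap.funLeft K K
      (fun w : {w : Fin k → Fin (e + 2) // (∑ i, (w i : ℕ)) + J = k * (e + 1)} =>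
        (⟨fun l => w.1 (σ.symm l), by rw [Equiv.sum_comp σ.symm (fun i => (w.1 i : ℕ))]; exact w.2⟩ :
          {w : Fin k → Fin (e + 2) // (∑ i, (w i : ℕ)) + J = k * (e + 1)}))) x ∈
      LinearMap.ker (Matrix.vecMulLinear
      (Matrix.of fun (v : {v : Fin k → Fin (e + 2) // (∑ i, (v i : ℕ)) + J = k * (e + 1)})
          (m : {m : Fin k → Fin (e + 2) // (∑ i, (m i : ℕ)) + L = k * (e + 1)}) =>
        ((((List.flatMap (colR (e + 3)))^[y] [List.ofFn (fun i => (m.1 i : ℕ))]).count (List.ofFn (fun i => (v.1 i : ℕ))) : ℕ) : K))) :=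
    fun x hx => comp_perm_mem_ker K k e y J L σ.symm x hx
  have g₂ := comap_subtype_le_comap_restrict K k e y c X J L σ.symm g₁
  refine Function.bijective_iff_has_inverse.mpr ⟨Submodule.mapQ _ _ ((LinearMap.funLeft K K
      (fun w : {w : Fin k → Fin (e + 2) // (∑ i, (w i : ℕ)) + J = k * (e + 1)} =>
        (⟨fun l => w.1 (σ.symm l), by rw [Equiv.sum_comp σ.symm (fun i => (w.1 i : ℕ))]; exact w.2⟩ :
          {w : Fin k → Fin (e + 2) // (∑ i, (w i : ℕ)) + J = k * (e + 1)}))).restrict g₁) g₂, fun q => ?_, fun q => ?_⟩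
  · obtain ⟨z, rfl⟩ := Submodule.Quotient.mk_surjective _ q
    rw [Submodule.mapQ_apply, Submodule.mapQ_apply]
    congr 1
    apply Subtype.ext
    rw [LinearMap.coe_restrict_apply, LinearMap.coe_restrict_apply]
    funext w
    simp only [LinearMap.funLeft_apply]
    exact congrArg (Subtype.val z) (Subtype.ext (funext fun l => by simp))
  · obtain ⟨z, rfl⟩ := Submodule.Quotient.mk_surjective _ q
    rw [Submodule.mapQ_apply, Submodule.mapQ_apply]
    congr 1
    apply Subtype.ext
    rw [LinearMap.coe_restrict_apply, LinearMap.coe_restrict_apply]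
    funext w
    simp only [LinearMap.funLeft_apply]
    exact congrArg (Subtype.val z) (Subtype.ext (funext fun l => by simp))

end Summit.HodgeConjecture.HodgeConjecture.HodgeLocus.Census.UnitColumnSymmetry
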